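import Summits.QuantumFields.YangMills.Theorems.BalabanUVNodesN15KingModelToronOperator
import Literature.MathematicalPhysics.QuantumFieldTheory.King1986.CompositionLaw
import HarnessLib

/-!
# BalabanUVNodes ∕ N15 — THE KING-MODEL RUNG (PART Ͷ-k): KING's FULL PROPAGATOR AND EFFECTIVE LAPLACIAN (4.5) AT A TORON — with the COVARIANT block mean `Q^ω` of the tree's
# `B5ToronOperators118.QsOpTw` ([B9] (3.19) at a constant abelian background; King's (2.11)–(2.12) `Q_k(A)` at constant `A`), `G(ω) = (−cΔ_ω + m² + aQ^{ω*}Q^ω)⁻¹` exists and King's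
# `Δ^ω_eff = a − a²Q^ωG(ω)Q^{ω*}` IS the Fourier multiplier `(a⁻¹ + Σ_l|u^ω(p′,l)|²∕(m² + Δ_ω(p′+l)))⁻¹` — (4.5) with every symbol at the momentum SHIFTED BY THE HOLONOMY
# (Track A, DAG node N15 = NE2; FAN-OUT v1.1 §N15 s3 «KING-MODEL RUNG … NE2's analogue DECIDED in the model … + what the curved case adds»; count-neutral)

HONEST FRAMING.  Count-neutral (cell `pub-ymgap`, seat `pub-ymgap-dag-n15-e` g44; `--supports stmt-QuantumFields-27247 --as helper` = K3ᴬ, KEY MAP v3).  Two-level torus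
`T_η = Π_μℤ∕(N·M_μ)` over `T₁ = Π_μℤ∕M_μ` (`N = L^k` fine points per block side, `η = N⁻¹`, fine lattice factor `c = N²`); King's `A = 0` block-spin objects [King1986] (2.13)–(2.14),
(4.5) are the comparison (the tree's `King1986.EffectiveLaplacianSymbol` proves (4.5) as an operator identity at `A = 0`); the link field is a constant abelian (flat) `U(1)` field `ω`
and the block mean is the COVARIANT one with straight-contour transport from the block base point (`QsOpTw`; a different base point changes `Q^ω` by a global unit phase per block,
which cancels in `Q^{ω*}…Q^ω` — `B5ToronOperators118` (R1)).  This IS the block term at a live flat field, so the object here is King's full `G_k(ω)` in his scalar model — NOT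
Bałaban's vector-field `G_k(U)` of [Balaban1985BackgroundPropagators] (3.24) (no Landau-gauge projection, no curvature); NOT a node discharge; nothing continuum-YM ∕ ℝ⁴ ∕ OS ∕ Clay.

THE RESULTS (`a > 0`, `m² > 0`, `c ≥ 0`, every unit `ω`; `B_ω := toronOp (fine N M) c m² ω` of PART Ͷ-a, `Q^ω := QsOpTw N M ω`, King's η-adjoint `Q^{ω*} := N^{d+1}·(Q^ω)ᴴ`):
* §1 `kingQadjTw`, `fineOpTw a c m² ω := B_ω + a·Q^{ω*}Q^ω` (King's (2.13) `A₀` at the toron), ★ `fineOpTw_posDef` ∕ `isUnit_fineOpTw` (the full toron propagator `G(ω) = (fineOpTw)⁻¹` EXISTS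
  for every unit `ω`), `fineOpTw_one` (recovery of the `A = 0` letters);
* §2 `effLapTw a c m² ω := a·1 − a²·Q^ωG(ω)Q^{ω*}` (King's (2.14)∕(4.5) `Δ^{(k)}` at the toron) and ★★★ **`effLapTw_eq_inv`** — WOODBURY: `Δ^ω_eff = (a⁻¹·1 + Q^ωB_ω⁻¹Q^{ω*})⁻¹`
  (Mathlib `Matrix.add_mul_mul_inv_eq_sub`);
* §3 the coarse multiplier: `dft_toronOp_inv_apply` (`B_ω⁻¹` is the Fourier multiplier `(m² + lsymTw)⁻¹`), `sigTw ω q := Σ_k |uTw(k,q)|²·(m² + lsymTw(p′+l_k))⁻¹` (real, `≥ 0`), ★★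
  **`dft_sandwichTw_apply`** (`(Q^ωB_ω⁻¹Q^{ω*}g)^(p′) = sigTw(p′)·ĝ(p′)` — the tree's `dft_QsOpTw` ∕ `dft_QsOpTw_adjoint` and `N^{d+1}c_Q² = 1`), ★★★ **`dft_effLapTw_apply`** — KING's
  (4.5) AT THE TORON: `(Δ^ω_eff g)^(p′) = (a⁻¹ + sigTw(p′))⁻¹·ĝ(p′)`;
* §4 at a unit twist `ω = e^{iφ}`: ★★ `sigTw_twistOf` — `sigTw = Σ_k ‖uSym N k s′‖²·(m² + Δ(shiftr N k s′))⁻¹` with `s′ = p′ + Nφ` (the tree's `uTw_twistOf`, `lsymTw_pOf_twistOf`): every symbol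
  of (4.5) is evaluated at the momentum shifted by the holonomy; RECOVERY `sigTw_one` (at `ω = 1` the flat `u(p′+l)`, `Δ(p′+l)`);
* §5 ★★★ **`effLapTw_symbol_eq_DeltaEff`** ∕ **`dft_effLapTw_apply_eq_DeltaEff`** — KING's (4.5) SYMBOL BY NAME: on the Brillouin zone of the shifted momentum (`|s′_μ| ≤ π`),
  `(a⁻¹ + sigTw(p′))⁻¹ = DeltaEff a N m² s′` — the tree's `King1986.DeltaEff` (`CompositionLaw`: «Δ^{(k)}(p′) = (a_k⁻¹ + Σ_l|u_k^η(p′+l)|²Δ^η(p′+l)⁻¹)⁻¹») evaluated AT `s′ = p′ + Nφ`, so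
  `(Δ^ω_eff g)^(p′) = Δ^{(k)}(s′)·ĝ(p′)`; `effLapTw_symbol_pos` (`DeltaEff_pos` by name).
WHAT THIS BUYS (LOCATED, by name): the tree's SYMBOL-LEVEL Lemma 4.1 ∕ 4.2 ∕ 4.3 and Prop. 3.10 (`King1986.EffectiveLaplacianRate.abs_effSymbol_sub_le_of_ref`, `CompositionRate.lemma42`,
`prop310_rate`) are stated for ARBITRARY real momenta, so they apply to `(a⁻¹ + sigTw)⁻¹` at `s′` once the aliasing identity `Σ_l|u(s′+l)|² = 1` (`King1986.AliasingIdentity`) is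
invoked at `s′` — NE2's unit-layer η-rate in King's model at a live FLAT link field; the composition over scales at a toron is the successor file.

PRIOR TREE ART (by name, not restated): Ͷ-a (`toronOp`, `toronOp_eq_spectral`, `toronOp_posDef`, `norm_twistOf_eq_one`), `B5ToronOperators118` (`QsOpTw`, `QsOpTw_one`), `B5ToronMomentum161`
(`uTw`, `uTw_one`, `uTw_twistOf`, `lsymTw`, `lsymTw_eq_sum_norm_sq`, `lsymTw_pOf_twistOf`, `sOfTw`, `dft_QsOpTw`, `dft_QsOpTw_adjoint`, `twistOf`), `B5Block118` (`pOf`, `cQ`, `cQ_eq`), `B5Prop11Plancherel`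
(`fine`, `dft`, `dft_mem_unitaryGroup`), `B5LaplaceInverse` (`dft_mul_conjTranspose`, `dft_conjTranspose_mul`), `B5Prop11Fiber` (`uSym`), `B4Strip` (`DeltaXir`, `shiftr`), Mathlib
(`Matrix.add_mul_mul_inv_eq_sub`, `PosDef.add_posSemidef`, `posSemidef_conjTranspose_mul_self`).  Dedup (rg at filing): basename 0 files; needles `fineOpTw|effLapTw|sigTw|kingQadjTw|dft_effLapTw_apply`
0 tree files; `King1986.CompositionLaw` (`DeltaEff`, `DeltaEff_pos`), `CompositionRate` (`composedInvResc`), `B5Prop11Fiber.norm_uSym_sq`, `B4Strip.Ur`.  Locators: [King1986] (2.11)–(2.12) p.653 (the COVARIANT block mean with contour transport; (2.10) on the same page is the gauge-field mean), (2.13)–(2.14) p.653, (4.5) p.670, (4.1)–(4.3) p.670, p.671; [Balaban1985BackgroundPropagators] (3.19) p.393, (3.23) p.394;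
[Balaban1984PropagatorsI] (1.20) p.20, (1.30)–(1.31) p.23; [tHooft1979Flux] NPB 153 (notion only).  0 `sorry`, 4 `def`.
v1.1 (DOC-ONLY, ERRATUM-Ͷ3 = ref-I READ-1029 LOCATED-1): King's covariant block mean `Q_k(A)φ` with the contour `Γ` is (2.11)–(2.12) on p.653 — v1.0 wrote «(2.10) p.652» ((2.10), on p.653 too, is the
gauge-field mean `Q_kA_μ`); three locators corrected, declarations byte-identical to v1.0.
-/

noncomputable section

open scoped BigOperators ComplexConjugate ComplexOrder
open Finset Matrix Complex

namespace Summit.QuantumFields.YangMills.BalabanUVNodes.N15KingModelRung.Toron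

open Literature.MathematicalPhysics.QuantumFieldTheory.Balaban1983to89.B5Prop11Plancherel
open Literature.MathematicalPhysics.QuantumFieldTheory.Balaban1983to89.B5Prop11Fiber (uSym norm_uSym_sq)
open Literature.MathematicalPhysics.QuantumFieldTheory.Balaban1983to89.B4Strip (DeltaXir shiftr Ur)
open Literature.MathematicalPhysics.QuantumFieldTheory.King1986 (DeltaEff composedInvResc)
open Literature.MathematicalPhysics.QuantumFieldTheory.Balaban1983to89.B5Block118 (pOf cQ cQ_eq)
open Literature.MathematicalPhysics.QuantumFieldTheory.Balaban1983to89.B5LaplaceInverse (dft_conjTranspose_mul dft_mul_conjTranspose)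
open Literature.MathematicalPhysics.QuantumFieldTheory.Balaban1983to89.B5ToronOperators118 (QsOpTw QsOpTw_one LapSTw)
open Literature.MathematicalPhysics.QuantumFieldTheory.Balaban1983to89.B5ToronMomentum161 (uTw uTw_one uTw_twistOf lsymTw lsymTw_eq_sum_norm_sq lsymTw_pOf_twistOf sOfTw twistOf
  dft_QsOpTw dft_QsOpTw_adjoint)

variable {d : ℕ} (N : ℕ) [NeZero N] (M : Fin (d + 1) → ℕ) [hM : ∀ μ, NeZero (M μ)]

/-! ## §1 King's full fine operator at a toron: `A₀(ω) = (−cΔ_ω + m²) + a·Q^{ω*}Q^ω` -/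
section FineOp

/-- KING's η-ADJOINT of the covariant block mean: `Q^{ω*} := N^{d+1}·(Q^ω)ᴴ` (adjoint for the `η^{d+1}`-weighted fine inner product; King's `Q^*`, B5's (1.74) normalisation).
[cite: King1986, (2.11) p.653, (2.13) p.653; Balaban1984PropagatorsI, (1.74) p.30] -/
def kingQadjTw (ω : Fin (d + 1) → ℂ) : Matrix (Tor (fine N M)) (Tor M) ℂ := ((N : ℂ) ^ (d + 1)) • (QsOpTw N M ω)ᴴ

/-- KING's FULL FINE OPERATOR AT THE TORON: `A₀(ω) = (−cΔ_ω + m²) + a·Q^{ω*}Q^ω` ((2.13) with the covariant block mean at the constant link field `ω`).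
[cite: King1986, (2.13) p.653; Balaban1985BackgroundPropagators, (3.19) p.393, (3.23) p.394] -/
def fineOpTw (a c m2 : ℝ) (ω : Fin (d + 1) → ℂ) : Matrix (Tor (fine N M)) (Tor (fine N M)) ℂ :=
  toronOp (fine N M) c m2 ω + (a : ℂ) • (kingQadjTw N M ω * QsOpTw N M ω)

/-- `Q^{ω*}Q^ω = N^{d+1}·(Q^ω)ᴴQ^ω` is positive semidefinite. [folklore] -/
theorem posSemidef_kingQadjTw_mul (ω : Fin (d + 1) → ℂ) : (kingQadjTw N M ω * QsOpTw N M ω).PosSemidef := by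
  rw [kingQadjTw, Matrix.smul_mul]
  have h := Matrix.posSemidef_conjTranspose_mul_self (QsOpTw N M ω)
  have hN : (0 : ℂ) ≤ (N : ℂ) ^ (d + 1) := by exact_mod_cast (pow_nonneg (Nat.cast_nonneg N) (d + 1))
  exact h.smul hN

/-- ★ `A₀(ω)` IS POSITIVE DEFINITE (unit `ω`, `c ≥ 0`, `m² > 0`, `a ≥ 0`). [cite: King1986, (2.13) p.653] -/
theorem fineOpTw_posDef {a c m2 : ℝ} (ha : 0 ≤ a) (hc : 0 ≤ c) (hm : 0 < m2) {ω : Fin (d + 1) → ℂ} (hω : ∀ μ, ‖ω μ‖ = 1) :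
    (fineOpTw N M a c m2 ω).PosDef := by
  unfold fineOpTw
  refine (toronOp_posDef (fine N M) hc hm hω).add_posSemidef ?_
  have ha' : (0 : ℂ) ≤ (a : ℂ) := by exact_mod_cast ha
  exact (posSemidef_kingQadjTw_mul N M ω).smul ha'

/-- ★ THE FULL TORON PROPAGATOR `G(ω) = A₀(ω)⁻¹` EXISTS (unit `ω`, `c ≥ 0`, `m² > 0`, `a ≥ 0`). [cite: King1986, (2.13) p.653] -/
theorem isUnit_fineOpTw {a c m2 : ℝ} (ha : 0 ≤ a) (hc : 0 ≤ c) (hm : 0 < m2) {ω : Fin (d + 1) → ℂ} (hω : ∀ μ, ‖ω μ‖ = 1) :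
    IsUnit (fineOpTw N M a c m2 ω) :=
  (fineOpTw_posDef N M ha hc hm hω).isUnit

/-- RECOVERY: at `ω ≡ 1` the block mean is B5's flat `Q′` (`QsOpTw_one`) and `B_1 = m² + LapS` — King's `A = 0` letters. [cite: King1986, (2.13) p.653] -/
theorem fineOpTw_one (a c m2 : ℝ) :
    fineOpTw N M a c m2 (fun _ => (1 : ℂ)) = toronOp (fine N M) c m2 (fun _ => (1 : ℂ))
      + (a : ℂ) • (((N : ℂ) ^ (d + 1)) • (Literature.MathematicalPhysics.QuantumFieldTheory.Balaban1983to89.B5Block118.QsOp N M)ᴴ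
          * Literature.MathematicalPhysics.QuantumFieldTheory.Balaban1983to89.B5Block118.QsOp N M) := by
  rw [fineOpTw, kingQadjTw, show (fun _ : Fin (d + 1) => (1 : ℂ)) = 1 from rfl, QsOpTw_one]

end FineOp

/-! ## §2 King's effective Laplacian at the toron and the Woodbury identity -/
section Woodbury

/-- KING's EFFECTIVE LAPLACIAN AT THE TORON: `Δ^ω_eff := a·1 − a²·Q^ω·G(ω)·Q^{ω*}` ((2.14)∕(4.5) `Δ^{(k)} = a_k − a_k²Q_kG_kQ_k^*` with the covariant block mean).
[cite: King1986, (2.14) p.653, (4.5) p.670] -/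
def effLapTw (a c m2 : ℝ) (ω : Fin (d + 1) → ℂ) : Matrix (Tor M) (Tor M) ℂ :=
  (a : ℂ) • (1 : Matrix (Tor M) (Tor M) ℂ) - ((a : ℂ) ^ 2) • (QsOpTw N M ω * (fineOpTw N M a c m2 ω)⁻¹ * kingQadjTw N M ω)

/-- ★★★ **WOODBURY: `Δ^ω_eff = (a⁻¹·1 + Q^ω·B_ω⁻¹·Q^{ω*})⁻¹`** (`a > 0`, `m² > 0`, `c ≥ 0`, unit `ω`) — King's (4.5) in operator form at the toron.
[cite: King1986, (4.5) p.670, (2.14) p.653] -/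
theorem effLapTw_eq_inv {a c m2 : ℝ} (ha : 0 < a) (hc : 0 ≤ c) (hm : 0 < m2) {ω : Fin (d + 1) → ℂ} (hω : ∀ μ, ‖ω μ‖ = 1) :
    effLapTw N M a c m2 ω = (((a : ℂ)⁻¹) • (1 : Matrix (Tor M) (Tor M) ℂ) + QsOpTw N M ω * (toronOp (fine N M) c m2 ω)⁻¹ * kingQadjTw N M ω)⁻¹ := by
  have hac : (a : ℂ) ≠ 0 := by exact_mod_cast ha.ne'
  set B := toronOp (fine N M) c m2 ω with hB
  have hBu : IsUnit B := (toronOp_posDef (fine N M) hc hm hω).isUnit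
  have hBdet : IsUnit B.det := (Matrix.isUnit_iff_isUnit_det _).mp hBu
  -- Woodbury with `A = a⁻¹·1`, `U = Q^ω`, `C = B⁻¹`, `V = Q^{ω*}`
  have hA : IsUnit (((a : ℂ)⁻¹) • (1 : Matrix (Tor M) (Tor M) ℂ)) := by
    refine IsUnit.of_mul_eq_one ((a : ℂ) • (1 : Matrix (Tor M) (Tor M) ℂ)) ?_
    rw [smul_mul_smul_comm, Matrix.mul_one, inv_mul_cancel₀ hac, one_smul]
  have hAinv : (((a : ℂ)⁻¹) • (1 : Matrix (Tor M) (Tor M) ℂ))⁻¹ = (a : ℂ) • (1 : Matrix (Tor M) (Tor M) ℂ) := by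
    refine Matrix.inv_eq_right_inv ?_
    rw [smul_mul_smul_comm, Matrix.mul_one, inv_mul_cancel₀ hac, one_smul]
  have hC : IsUnit B⁻¹ := by
    refine IsUnit.of_mul_eq_one B ?_
    rw [Matrix.nonsing_inv_mul _ hBdet]
  have hCinv : B⁻¹⁻¹ = B := Matrix.nonsing_inv_nonsing_inv _ hBdet
  have hfine : B⁻¹⁻¹ + kingQadjTw N M ω * (((a : ℂ)⁻¹) • (1 : Matrix (Tor M) (Tor M) ℂ))⁻¹ * QsOpTw N M ω = fineOpTw N M a c m2 ω := by
    rw [hCinv, hAinv, Matrix.mul_smul, Matrix.mul_one, Matrix.smul_mul, fineOpTw]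
  have hAC : IsUnit (B⁻¹⁻¹ + kingQadjTw N M ω * (((a : ℂ)⁻¹) • (1 : Matrix (Tor M) (Tor M) ℂ))⁻¹ * QsOpTw N M ω) := by
    rw [hfine]; exact isUnit_fineOpTw N M ha.le hc hm hω
  have hW := Matrix.add_mul_mul_inv_eq_sub (((a : ℂ)⁻¹) • (1 : Matrix (Tor M) (Tor M) ℂ)) (QsOpTw N M ω) B⁻¹ (kingQadjTw N M ω) hA hC hAC
  rw [hfine, hAinv] at hW
  rw [hW, effLapTw]
  simp only [Matrix.smul_mul, Matrix.mul_smul, Matrix.one_mul, Matrix.mul_one, smul_smul, sq]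

end Woodbury

/-! ## §3 The coarse Fourier multiplier of `Q^ωB_ω⁻¹Q^{ω*}` and King's (4.5) at the toron -/
section Symbol

/-- The fine multiplier `m² + lsymTw` is a positive real (`c ≥ 0`, `m² > 0`), in particular non-zero. [folklore] -/
theorem mass_add_lsymTw_ne_zero (c : ℝ) {m2 : ℝ} (hm : 0 < m2) (ω : Fin (d + 1) → ℂ) (p : Tor (fine N M)) :
    (m2 : ℂ) + lsymTw (fine N M) ((Real.sqrt c : ℝ) : ℂ) ω p ≠ 0 := by
  rw [lsymTw_eq_sum_norm_sq, ← Complex.ofReal_add]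
  exact_mod_cast (ne_of_gt (add_pos_of_pos_of_nonneg hm (Finset.sum_nonneg fun _ _ => sq_nonneg _)))

/-- ★ `B_ω⁻¹ = dft^*·diag((m² + lsymTw)⁻¹)·dft` (`c ≥ 0`, `m² > 0`, unit `ω`). [cite: King1986, (4.4) p.670] -/
theorem toronOp_inv_eq_spectral {c m2 : ℝ} (hc : 0 ≤ c) (hm : 0 < m2) {ω : Fin (d + 1) → ℂ} (hω : ∀ μ, ‖ω μ‖ = 1) :
    (toronOp (fine N M) c m2 ω)⁻¹
      = (dft (fine N M))ᴴ * Matrix.diagonal (fun p => ((m2 : ℂ) + lsymTw (fine N M) ((Real.sqrt c : ℝ) : ℂ) ω p)⁻¹) * dft (fine N M) := by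
  refine Matrix.inv_eq_right_inv ?_
  rw [toronOp_eq_spectral (fine N M) hc m2 hω]
  calc (dft (fine N M))ᴴ * Matrix.diagonal (fun q => (m2 : ℂ) + lsymTw (fine N M) ((Real.sqrt c : ℝ) : ℂ) ω q) * dft (fine N M)
        * ((dft (fine N M))ᴴ * Matrix.diagonal (fun p => ((m2 : ℂ) + lsymTw (fine N M) ((Real.sqrt c : ℝ) : ℂ) ω p)⁻¹) * dft (fine N M))
      = (dft (fine N M))ᴴ * (Matrix.diagonal (fun q => (m2 : ℂ) + lsymTw (fine N M) ((Real.sqrt c : ℝ) : ℂ) ω q)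
          * (dft (fine N M) * (dft (fine N M))ᴴ) * Matrix.diagonal (fun p => ((m2 : ℂ) + lsymTw (fine N M) ((Real.sqrt c : ℝ) : ℂ) ω p)⁻¹)) * dft (fine N M) := by
        simp only [Matrix.mul_assoc]
    _ = 1 := by
        rw [dft_mul_conjTranspose, Matrix.mul_one, Matrix.diagonal_mul_diagonal]
        have : (fun i => ((m2 : ℂ) + lsymTw (fine N M) ((Real.sqrt c : ℝ) : ℂ) ω i) * ((m2 : ℂ) + lsymTw (fine N M) ((Real.sqrt c : ℝ) : ℂ) ω i)⁻¹) = fun _ => 1 :=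
          funext fun i => mul_inv_cancel₀ (mass_add_lsymTw_ne_zero N M c hm ω i)
        rw [this, Matrix.diagonal_one, Matrix.mul_one, dft_conjTranspose_mul]

/-- `(B_ω⁻¹h)^(p) = (m² + lsymTw(p))⁻¹·ĥ(p)` — the fine covariance is a Fourier multiplier. [cite: King1986, (4.4) p.670] -/
theorem dft_toronOp_inv_apply {c m2 : ℝ} (hc : 0 ≤ c) (hm : 0 < m2) {ω : Fin (d + 1) → ℂ} (hω : ∀ μ, ‖ω μ‖ = 1) (h : Tor (fine N M) → ℂ) (p : Tor (fine N M)) :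
    (dft (fine N M) *ᵥ ((toronOp (fine N M) c m2 ω)⁻¹ *ᵥ h)) p = ((m2 : ℂ) + lsymTw (fine N M) ((Real.sqrt c : ℝ) : ℂ) ω p)⁻¹ * (dft (fine N M) *ᵥ h) p := by
  have hmat : dft (fine N M) * (toronOp (fine N M) c m2 ω)⁻¹
      = Matrix.diagonal (fun p => ((m2 : ℂ) + lsymTw (fine N M) ((Real.sqrt c : ℝ) : ℂ) ω p)⁻¹) * dft (fine N M) := by
    rw [toronOp_inv_eq_spectral N M hc hm hω, ← Matrix.mul_assoc, ← Matrix.mul_assoc, dft_mul_conjTranspose, Matrix.one_mul]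
  rw [Matrix.mulVec_mulVec, hmat, ← Matrix.mulVec_mulVec, Matrix.mulVec_diagonal]

/-- THE COARSE MULTIPLIER `sigTw(p′) = Σ_k |uTw(k,p′)|²·(m² + lsymTw(p′+l_k))⁻¹` — King's alias sum of (4.5) with the TWISTED block weights and the TWISTED fine symbol.
[cite: King1986, (4.5) p.670; Balaban1984PropagatorsI, (1.30)-(1.31) p.23] -/
def sigTw (c m2 : ℝ) (ω : Fin (d + 1) → ℂ) (q : Tor M) : ℂ :=
  ∑ k : Fin (d + 1) → Fin N, uTw N M ω k q * conj (uTw N M ω k q) * ((m2 : ℂ) + lsymTw (fine N M) ((Real.sqrt c : ℝ) : ℂ) ω (pOf N M (k, q)))⁻¹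

/-- `N^{d+1}·c_Q² = 1` (the normalisations of King's adjoint and of the twisted (1.30) cancel). [folklore] -/
theorem pow_mul_cQ_sq : ((N : ℂ) ^ (d + 1)) * ((cQ N M : ℂ) * (cQ N M : ℂ)) = 1 := by
  rw [cQ_eq, ← Complex.ofReal_mul, ← mul_inv, Real.mul_self_sqrt (pow_nonneg (Nat.cast_nonneg N) _)]
  have hN : ((N : ℝ) ^ (d + 1)) ≠ 0 := pow_ne_zero _ (by exact_mod_cast NeZero.ne N)
  push_cast
  rw [mul_inv_cancel₀ (by exact_mod_cast hN)]

/-- ★★ **THE COARSE MULTIPLIER OF `Q^ωB_ω⁻¹Q^{ω*}`**: `(Q^ωB_ω⁻¹Q^{ω*}g)^(p′) = sigTw(p′)·ĝ(p′)` (the tree's twisted (1.30) `dft_QsOpTw` and its adjoint, the fine multiplier, and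
`N^{d+1}c_Q² = 1`). [cite: King1986, (4.5) p.670; Balaban1984PropagatorsI, (1.30) p.23] -/
theorem dft_sandwichTw_apply {c m2 : ℝ} (hc : 0 ≤ c) (hm : 0 < m2) {ω : Fin (d + 1) → ℂ} (hω : ∀ μ, ‖ω μ‖ = 1) (g : Tor M → ℂ) (q : Tor M) :
    (dft M *ᵥ ((QsOpTw N M ω * (toronOp (fine N M) c m2 ω)⁻¹ * kingQadjTw N M ω) *ᵥ g)) q = sigTw N M c m2 ω q * (dft M *ᵥ g) q := by
  rw [← Matrix.mulVec_mulVec, ← Matrix.mulVec_mulVec, kingQadjTw, Matrix.smul_mulVec, Matrix.mulVec_smul, Matrix.mulVec_smul, Matrix.mulVec_smul, Pi.smul_apply, smul_eq_mul,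
    dft_QsOpTw]
  simp_rw [dft_toronOp_inv_apply N M hc hm hω, dft_QsOpTw_adjoint]
  rw [sigTw, Finset.sum_mul, Finset.mul_sum, Finset.mul_sum]
  refine Finset.sum_congr rfl fun k _ => ?_
  have h1 := pow_mul_cQ_sq N M (d := d)
  calc (N : ℂ) ^ (d + 1) * ((cQ N M : ℂ) * (uTw N M ω k q * (((m2 : ℂ) + lsymTw (fine N M) ((Real.sqrt c : ℝ) : ℂ) ω (pOf N M (k, q)))⁻¹
          * ((cQ N M : ℂ) * conj (uTw N M ω k q) * (dft M *ᵥ g) q))))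
      = ((N : ℂ) ^ (d + 1) * ((cQ N M : ℂ) * (cQ N M : ℂ)))
          * (uTw N M ω k q * conj (uTw N M ω k q) * ((m2 : ℂ) + lsymTw (fine N M) ((Real.sqrt c : ℝ) : ℂ) ω (pOf N M (k, q)))⁻¹ * (dft M *ᵥ g) q) := by ring
    _ = _ := by rw [h1, one_mul]

/-- `sigTw(p′)` is a non-negative real number. [folklore] -/
theorem sigTw_eq_ofReal (c : ℝ) {m2 : ℝ} (hm : 0 < m2) (ω : Fin (d + 1) → ℂ) (q : Tor M) :
    ∃ r : ℝ, 0 ≤ r ∧ sigTw N M c m2 ω q = (r : ℂ) := by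
  refine ⟨∑ k : Fin (d + 1) → Fin N, ‖uTw N M ω k q‖ ^ 2 * (m2 + ∑ ν, ‖Literature.MathematicalPhysics.QuantumFieldTheory.Balaban1983to89.B5ToronMomentum161.ssymTw (fine N M)
      ((Real.sqrt c : ℝ) : ℂ) ω ν (pOf N M (k, q))‖ ^ 2)⁻¹, Finset.sum_nonneg fun k _ => mul_nonneg (sq_nonneg _) (inv_nonneg.mpr (by positivity)), ?_⟩
  rw [sigTw, Complex.ofReal_sum]
  refine Finset.sum_congr rfl fun k _ => ?_
  rw [lsymTw_eq_sum_norm_sq, Complex.mul_conj', ← Complex.ofReal_add, ← Complex.ofReal_inv]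
  push_cast
  ring

/-- `a⁻¹ + sigTw(p′) ≠ 0` (`a > 0`). [folklore] -/
theorem inv_add_sigTw_ne_zero {a : ℝ} (c : ℝ) {m2 : ℝ} (ha : 0 < a) (hm : 0 < m2) (ω : Fin (d + 1) → ℂ) (q : Tor M) :
    (a : ℂ)⁻¹ + sigTw N M c m2 ω q ≠ 0 := by
  obtain ⟨r, hr, h⟩ := sigTw_eq_ofReal N M c hm ω q
  rw [h, ← Complex.ofReal_inv, ← Complex.ofReal_add]
  exact_mod_cast (ne_of_gt (add_pos_of_pos_of_nonneg (inv_pos.mpr ha) hr))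

/-- `Q^ωB_ω⁻¹Q^{ω*} = dft^*·diag(sigTw)·dft`. [cite: King1986, (4.5) p.670] -/
theorem sandwichTw_eq_spectral {c m2 : ℝ} (hc : 0 ≤ c) (hm : 0 < m2) {ω : Fin (d + 1) → ℂ} (hω : ∀ μ, ‖ω μ‖ = 1) :
    QsOpTw N M ω * (toronOp (fine N M) c m2 ω)⁻¹ * kingQadjTw N M ω = (dft M)ᴴ * Matrix.diagonal (sigTw N M c m2 ω) * dft M := by
  have key : dft M * (QsOpTw N M ω * (toronOp (fine N M) c m2 ω)⁻¹ * kingQadjTw N M ω) = Matrix.diagonal (sigTw N M c m2 ω) * dft M := by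
    rw [Matrix.ext_iff_mulVec]
    intro g
    funext q
    rw [← Matrix.mulVec_mulVec, dft_sandwichTw_apply N M hc hm hω, ← Matrix.mulVec_mulVec, Matrix.mulVec_diagonal]
  calc QsOpTw N M ω * (toronOp (fine N M) c m2 ω)⁻¹ * kingQadjTw N M ω
      = (dft M)ᴴ * dft M * (QsOpTw N M ω * (toronOp (fine N M) c m2 ω)⁻¹ * kingQadjTw N M ω) := by rw [dft_conjTranspose_mul, Matrix.one_mul]
    _ = _ := by rw [Matrix.mul_assoc, key, ← Matrix.mul_assoc]

/-- ★★★ **KING's (4.5) AT THE TORON — THE EFFECTIVE LAPLACIAN IS THE FOURIER MULTIPLIER `(a⁻¹ + sigTw(p′))⁻¹`**: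
`Δ^ω_eff = dft^*·diag((a⁻¹ + Σ_k|uTw(k,p′)|²(m² + lsymTw(p′+l_k))⁻¹)⁻¹)·dft` (`a > 0`, `m² > 0`, `c ≥ 0`, unit `ω`). [cite: King1986, (4.5) p.670, (2.14) p.653; Balaban1984PropagatorsI, (1.30)-(1.31) p.23] -/
theorem effLapTw_eq_spectral {a c m2 : ℝ} (ha : 0 < a) (hc : 0 ≤ c) (hm : 0 < m2) {ω : Fin (d + 1) → ℂ} (hω : ∀ μ, ‖ω μ‖ = 1) :
    effLapTw N M a c m2 ω = (dft M)ᴴ * Matrix.diagonal (fun q => ((a : ℂ)⁻¹ + sigTw N M c m2 ω q)⁻¹) * dft M := by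
  rw [effLapTw_eq_inv N M ha hc hm hω, sandwichTw_eq_spectral N M hc hm hω]
  have hsum : ((a : ℂ)⁻¹) • (1 : Matrix (Tor M) (Tor M) ℂ) + (dft M)ᴴ * Matrix.diagonal (sigTw N M c m2 ω) * dft M
      = (dft M)ᴴ * Matrix.diagonal (fun q => (a : ℂ)⁻¹ + sigTw N M c m2 ω q) * dft M := by
    have h1 : ((a : ℂ)⁻¹) • (1 : Matrix (Tor M) (Tor M) ℂ) = (dft M)ᴴ * Matrix.diagonal (fun _ => (a : ℂ)⁻¹) * dft M := by
      rw [← Matrix.smul_one_eq_diagonal, Matrix.mul_smul, Matrix.mul_one, Matrix.smul_mul, dft_conjTranspose_mul]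
    rw [h1, ← Matrix.add_mul, ← Matrix.mul_add, Matrix.diagonal_add]
  rw [hsum]
  refine Matrix.inv_eq_right_inv ?_
  calc (dft M)ᴴ * Matrix.diagonal (fun q => (a : ℂ)⁻¹ + sigTw N M c m2 ω q) * dft M * ((dft M)ᴴ * Matrix.diagonal (fun q => ((a : ℂ)⁻¹ + sigTw N M c m2 ω q)⁻¹) * dft M)
      = (dft M)ᴴ * (Matrix.diagonal (fun q => (a : ℂ)⁻¹ + sigTw N M c m2 ω q) * (dft M * (dft M)ᴴ) * Matrix.diagonal (fun q => ((a : ℂ)⁻¹ + sigTw N M c m2 ω q)⁻¹)) * dft M := by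
        simp only [Matrix.mul_assoc]
    _ = 1 := by
        rw [dft_mul_conjTranspose, Matrix.mul_one, Matrix.diagonal_mul_diagonal]
        have : (fun i => ((a : ℂ)⁻¹ + sigTw N M c m2 ω i) * ((a : ℂ)⁻¹ + sigTw N M c m2 ω i)⁻¹) = fun _ => 1 :=
          funext fun i => mul_inv_cancel₀ (inv_add_sigTw_ne_zero N M c ha hm ω i)
        rw [this, Matrix.diagonal_one, Matrix.mul_one, dft_conjTranspose_mul]

/-- ★★★ (4.5) on test functions: `(Δ^ω_eff g)^(p′) = (a⁻¹ + sigTw(p′))⁻¹·ĝ(p′)`. [cite: King1986, (4.5) p.670] -/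
theorem dft_effLapTw_apply {a c m2 : ℝ} (ha : 0 < a) (hc : 0 ≤ c) (hm : 0 < m2) {ω : Fin (d + 1) → ℂ} (hω : ∀ μ, ‖ω μ‖ = 1) (g : Tor M → ℂ) (q : Tor M) :
    (dft M *ᵥ (effLapTw N M a c m2 ω *ᵥ g)) q = ((a : ℂ)⁻¹ + sigTw N M c m2 ω q)⁻¹ * (dft M *ᵥ g) q := by
  have hmat : dft M * effLapTw N M a c m2 ω = Matrix.diagonal (fun q => ((a : ℂ)⁻¹ + sigTw N M c m2 ω q)⁻¹) * dft M := by
    rw [effLapTw_eq_spectral N M ha hc hm hω, ← Matrix.mul_assoc, ← Matrix.mul_assoc, dft_mul_conjTranspose, Matrix.one_mul]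
  rw [Matrix.mulVec_mulVec, hmat, ← Matrix.mulVec_mulVec, Matrix.mulVec_diagonal]

end Symbol

/-! ## §4 At a unit twist: every symbol at the momentum shifted by the holonomy; recovery at `ω = 1` -/
section Shift

/-- ★★ **THE SHIFT**: at `ω = e^{iφ}` and `c = N²` (King's units `η = N⁻¹`), `sigTw(p′) = Σ_k ‖u(s′+l_k)‖²·(m² + Δ(s′+l_k))⁻¹` with `s′ = p′ + Nφ` — the tree's flat letters `uSym`,
`DeltaXir N 0 ∘ shiftr` at the SHIFTED real momentum (`uTw_twistOf`, `lsymTw_pOf_twistOf`). [cite: King1986, (4.5) p.670; Balaban1984PropagatorsI, (1.31) p.23] -/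
theorem sigTw_twistOf (m2 : ℝ) (φ : Fin (d + 1) → ℝ) (q : Tor M) :
    sigTw N M ((N : ℝ) ^ 2) m2 (twistOf φ) q
      = ∑ k : Fin (d + 1) → Fin N, (((‖uSym N k (sOfTw N M φ q)‖ ^ 2 : ℝ) : ℂ)) * ((m2 : ℂ) + ((DeltaXir N 0 (shiftr N k (sOfTw N M φ q)) : ℝ) : ℂ))⁻¹ := by
  unfold sigTw
  have hsqrt : ((Real.sqrt ((N : ℝ) ^ 2) : ℝ) : ℂ) = (N : ℂ) := by rw [Real.sqrt_sq (Nat.cast_nonneg N)]; push_cast; rfl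
  refine Finset.sum_congr rfl fun k _ => ?_
  rw [uTw_twistOf, hsqrt, lsymTw_pOf_twistOf, Complex.mul_conj']
  push_cast
  rfl

/-- RECOVERY: at `ω ≡ 1`, `sigTw(p′) = Σ_k ‖u(p′+l_k)‖²·(m² + lsym(p′+l_k))⁻¹` — King's `A = 0` alias sum with the flat block weights (`uTw_one`). [cite: King1986, (4.5) p.670] -/
theorem sigTw_one (c m2 : ℝ) (q : Tor M) :
    sigTw N M c m2 (fun _ => (1 : ℂ)) q
      = ∑ k : Fin (d + 1) → Fin N, (((‖uSym N k (sOf M q)‖ ^ 2 : ℝ) : ℂ)) * ((m2 : ℂ) + lsymTw (fine N M) ((Real.sqrt c : ℝ) : ℂ) (fun _ => (1 : ℂ)) (pOf N M (k, q)))⁻¹ := by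
  unfold sigTw
  refine Finset.sum_congr rfl fun k _ => ?_
  rw [show (fun _ : Fin (d + 1) => (1 : ℂ)) = 1 from rfl, uTw_one, Complex.mul_conj']
  push_cast
  rfl

end Shift

/-! ## §5 King's (4.5) symbol `Δ^{(k)}` BY NAME at the shifted momentum -/
section ByName

/-- ★★★ **KING's (4.5) SYMBOL BY NAME AT THE SHIFTED MOMENTUM**: for `a > 0`, `c = N²`, on the Brillouin zone of `s′ = p′ + Nφ` (`|s′_μ| ≤ π`),
`(a⁻¹ + sigTw(p′))⁻¹ = DeltaEff a N m² s′` — the tree's `King1986.DeltaEff` = «(4.5) `(a_k⁻¹ + Σ_l|u_k^η(p′+l)|²Δ^η(p′+l)⁻¹)⁻¹`» with every alias momentum shifted by the holonomy.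
[cite: King1986, (4.5) p.670, (4.3)-(4.4) p.670; Balaban1984PropagatorsI, (1.31) p.23] -/
theorem effLapTw_symbol_eq_DeltaEff (a m2 : ℝ) (φ : Fin (d + 1) → ℝ) (q : Tor M) (hzone : ∀ μ, |sOfTw N M φ q μ| ≤ Real.pi) :
    ((a : ℂ)⁻¹ + sigTw N M ((N : ℝ) ^ 2) m2 (twistOf φ) q)⁻¹ = ((DeltaEff a N m2 (sOfTw N M φ q) : ℝ) : ℂ) := by
  have hN1 : 1 ≤ N := Nat.one_le_iff_ne_zero.mpr (NeZero.ne N)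
  rw [sigTw_twistOf, DeltaEff, composedInvResc]
  simp_rw [norm_uSym_sq N hN1 _ _ hzone]
  have hD : ∀ k : Fin (d + 1) → Fin N, (m2 : ℂ) + ((DeltaXir N 0 (shiftr N k (sOfTw N M φ q)) : ℝ) : ℂ) = ((DeltaXir N m2 (shiftr N k (sOfTw N M φ q)) : ℝ) : ℂ) := by
    intro k; simp only [DeltaXir, add_zero]; push_cast; ring
  simp_rw [hD]
  push_cast
  rfl

/-- ★★★ **KING's (4.5) AT THE TORON, BY NAME**: `(Δ^ω_eff g)^(p′) = Δ^{(k)}(s′)·ĝ(p′)` with King's symbol `Δ^{(k)} = DeltaEff a N m²` at the shifted momentum `s′ = p′ + Nφ`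
(`a > 0`, `m² > 0`, `c = N²`, `|s′_μ| ≤ π`). [cite: King1986, (4.5) p.670, (2.14) p.653; Balaban1985BackgroundPropagators, (3.19) p.393, (3.23) p.394] -/
theorem dft_effLapTw_apply_eq_DeltaEff {a m2 : ℝ} (ha : 0 < a) (hm : 0 < m2) (φ : Fin (d + 1) → ℝ) (g : Tor M → ℂ) (q : Tor M)
    (hzone : ∀ μ, |sOfTw N M φ q μ| ≤ Real.pi) :
    (dft M *ᵥ (effLapTw N M a ((N : ℝ) ^ 2) m2 (twistOf φ) *ᵥ g)) q = ((DeltaEff a N m2 (sOfTw N M φ q) : ℝ) : ℂ) * (dft M *ᵥ g) q := by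
  rw [dft_effLapTw_apply N M ha (sq_nonneg _) hm (norm_twistOf_eq_one φ), effLapTw_symbol_eq_DeltaEff N M a m2 φ q hzone]

omit hM in
/-- ★ The toron effective symbol is POSITIVE off the zero shifted momentum (the tree's `DeltaEff_pos` at `s′`; `a > 0`, `m² ≥ 0`). [cite: King1986, p.671 («Δ^η … positive»)] -/
theorem effLapTw_symbol_pos {a : ℝ} (ha : 0 < a) {m2 : ℝ} (hm : 0 ≤ m2) (φ : Fin (d + 1) → ℝ) (q : Tor M) (hzone : ∀ μ, |sOfTw N M φ q μ| ≤ Real.pi)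
    (hp0 : 0 < Literature.MathematicalPhysics.QuantumFieldTheory.King1986.momSq (sOfTw N M φ q)) : 0 < DeltaEff a N m2 (sOfTw N M φ q) :=
  Literature.MathematicalPhysics.QuantumFieldTheory.King1986.DeltaEff_pos ha (Nat.one_le_iff_ne_zero.mpr (NeZero.ne N)) hm hzone hp0

end ByName

end Summit.QuantumFields.YangMills.BalabanUVNodes.N15KingModelRung.Toron

end
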